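import Summits.Ventures.LatticeQCDFlow.Scoring.U1TorusPlaquetteCovariance
import Summits.Ventures.LatticeQCDFlow.Scoring.U1TorusPlaquetteAverageVariance
import Literature.Analysis.FunctionSpaces.BesselIIntegralSeries
import HarnessLib

/-!
# The 2-d `U(1)` torus: `V·Var(P̄) → v(β) = 1 − t/β − t²` (`t = I₁/I₀`), with an explicit rate

HONEST FRAMING: exact (Metropolis-corrected) sampling algorithms for lattice gauge theory;
figures of merit are autocorrelation/cost numbers at stated couplings and volumes; no
continuum-physics claim.

Venture `LatticeQCDFlow` (cell pub-lqcd), sub-topic `Scoring`; FANOUT row 5 (`s0-sun-a`), GEN-13.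
NEW WORK of the cell (placement rule).  `Scoring/U1TorusPlaquetteAverageVariance.lean` (GEN-13) gives the
exact variance of the volume-averaged plaquette of the `L₁ × L₂` torus,
`Var(P̄) = (S/Z)/V + (1 − 1/V)(P/Z) − (N/Z)²`, `V = L₁L₂`, through the four series
`Z = Σ_k a_k^V`, `N = Σ_k a_k^{V−1}J_k`, `P = Σ_k a_k^{V−2}J_k²`, `S = Σ_k a_k^{V−1}Q_k`
(`a_k = I_{|k|}(β)`, `J_k = (a_{k−1}+a_{k+1})/2`, `Q_k = (a_{k−2}+2a_k+a_{k+2})/4`), and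
`Scoring/U1TorusPlaquetteCovariance.lean` bounds the pair covariance `0 ≤ P/Z − (N/Z)² ≤ 3ρ_V`,
`ρ_V = T/A − 1 = Σ_{k≠0}(a_k/a_0)^{V−2}`.  Here, for `β > 0` and `V ≥ 3`:

* §1 `|S/Z − P/Z − v(β)| ≤ 3ρ_V` with `v(β) = 1 − t/β − t²`, `t = I₁(β)/I₀(β)` — the infinite-volume
  single-plaquette variance `⟨cos²⟩ − ⟨cos⟩² = ½(1 + I₂/I₀) − (I₁/I₀)²` (`I₂ = I₀ − 2I₁/β`), `|v| ≤ 1`;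
* §2 `ρ_V ≤ t^{V−3}(e^β − 1)` (`a_k ≤ a_1` for `k ≠ 0`, `Σ_{k∈ℤ} a_k = e^β`, `a_0 ≥ 1`), hence
  **`abs_torusVariance_mul_sub_le`**: `|V·Var − v(β)| ≤ (3V + 3)·t^{V−3}·(e^β − 1)` and
  **`tendsto_torusVariance_mul`**: `V·Var → v(β)` as `V → ∞` (`0 ≤ t < 1`);
* §3 on the `L₁ × L₂` torus (`L₁L₂ ≥ 3`):
  **`abs_torus_plaquetteAverage_variance_mul_sub_le`**:
  `|L₁L₂·Var(P̄)_{L₁×L₂,β} − v(β)| ≤ (3L₁L₂ + 3)·t^{L₁L₂−3}·(e^β − 1)`.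

At the S0-B keys (`L = 16`) the right side is below `10⁻⁸⁶` (`β = 1`) … `2·10⁻⁵` (`β = 7`); the kernel
enclosures of `Scoring/U1TorusPlaquetteVarianceEnclosures.lean` resolve the `β = 6, 7` corrections.
Elementary; nothing is cited; no `def`.
-/

noncomputable section

open Real Finset Filter Topology
open scoped Nat
open Literature.Analysis.FunctionSpaces

namespace Summit.Ventures.LatticeQCDFlow.Scoring

/-! ### 1. The single-plaquette part: `|S/Z − P/Z − v(β)| ≤ 3ρ` -/

/-- `v(β) = 1 − t/β − t²` is the `k = 0` value `Q_0/a_0 − (J_0/a_0)²` (`I₂ = I₀ − 2I₁/β`), and `|v| ≤ 1`. -/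
theorem torusV_eq_and_abs_le {β : ℝ} (hβ : 0 < β) :
    1 - besselI 1 β / besselI 0 β / β - (besselI 1 β / besselI 0 β) ^ 2 =
      (besselI 0 β + besselI 2 β) / 2 / besselI 0 β - (besselI 1 β / besselI 0 β) ^ 2 ∧
    |1 - besselI 1 β / besselI 0 β / β - (besselI 1 β / besselI 0 β) ^ 2| ≤ 1 := by
  have hI0 : 0 < besselI 0 β := besselI_pos 0 hβ
  have hI1 : 0 < besselI 1 β := besselI_pos 1 hβ
  have hI2 : 0 < besselI 2 β := besselI_pos 2 hβ
  have h21 : besselI 2 β ≤ besselI 0 β := besselI_le_besselI_zero 2 β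
  have h10 : besselI 1 β ≤ besselI 0 β := besselI_le_besselI_zero 1 β
  have heq : 1 - besselI 1 β / besselI 0 β / β - (besselI 1 β / besselI 0 β) ^ 2 =
      (besselI 0 β + besselI 2 β) / 2 / besselI 0 β - (besselI 1 β / besselI 0 β) ^ 2 := by
    rw [besselI_two_eq hβ.ne']
    field_simp
    ring
  refine ⟨heq, ?_⟩
  rw [heq, abs_le]
  have ht : besselI 1 β / besselI 0 β ≤ 1 := (div_le_one hI0).mpr h10
  have ht0 : 0 ≤ besselI 1 β / besselI 0 β := div_nonneg hI1.le hI0.le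
  have ht2 : (besselI 1 β / besselI 0 β) ^ 2 ≤ 1 := pow_le_one₀ ht0 ht
  have hq1 : (besselI 0 β + besselI 2 β) / 2 / besselI 0 β ≤ 1 := by
    rw [div_le_one hI0]; linarith
  have hq0 : 0 ≤ (besselI 0 β + besselI 2 β) / 2 / besselI 0 β := by positivity
  constructor <;> nlinarith [sq_nonneg (besselI 1 β / besselI 0 β)]

/-- **`|S/Z − P/Z − v(β)| ≤ 3(T/A − 1)`** (`V = W + 3`, `A = a_0^{W+1}`, `T = Σ_k a_k^{W+1}`): the
single-plaquette variance is its infinite-volume value up to the `k ≠ 0` mass. -/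
theorem abs_torusS_div_sub_P_div_sub_le {β : ℝ} (hβ : 0 < β) (W : ℕ) :
    |(∑' k : ℤ, besselI k.natAbs β ^ (W + 2) *
          ((besselI (k - 2).natAbs β + 2 * besselI k.natAbs β + besselI (k + 2).natAbs β) / 4)) /
        (∑' k : ℤ, besselI k.natAbs β ^ (W + 3)) -
      (∑' k : ℤ, besselI k.natAbs β ^ (W + 1) *
          ((besselI (k - 1).natAbs β + besselI (k + 1).natAbs β) / 2) ^ 2) /
        (∑' k : ℤ, besselI k.natAbs β ^ (W + 3)) -
      (1 - besselI 1 β / besselI 0 β / β - (besselI 1 β / besselI 0 β) ^ 2)| ≤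
      3 * ((∑' k : ℤ, besselI k.natAbs β ^ (W + 1)) / besselI 0 β ^ (W + 1) - 1) := by
  set a : ℤ → ℝ := fun k => besselI k.natAbs β with ha
  set J : ℤ → ℝ := fun k => (besselI (k - 1).natAbs β + besselI (k + 1).natAbs β) / 2 with hJ
  set Q : ℤ → ℝ := fun k =>
    (besselI (k - 2).natAbs β + 2 * besselI k.natAbs β + besselI (k + 2).natAbs β) / 4 with hQ
  set v : ℝ := 1 - besselI 1 β / besselI 0 β / β - (besselI 1 β / besselI 0 β) ^ 2 with hv
  have ha0 : ∀ k, 0 < a k := fun k => besselI_pos _ hβ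
  have haI : ∀ k, a k ≤ besselI 0 β := fun k => besselI_le_besselI_zero _ β
  have hJ0 : ∀ k, 0 ≤ J k := fun k => (torusJ_mem hβ k).1
  have hJI : ∀ k, J k ≤ besselI 0 β := fun k => (torusJ_mem hβ k).2
  have hQ0 : ∀ k, 0 ≤ Q k := fun k => (torusQ_mem hβ k).1
  have hQI : ∀ k, Q k ≤ besselI 0 β := fun k => (torusQ_mem hβ k).2
  have hI0 : 0 < besselI 0 β := besselI_pos 0 hβ
  obtain ⟨hveq, hv1⟩ := torusV_eq_and_abs_le hβ
  have hSs : Summable fun k : ℤ => a k ^ (W + 2) * Q k := summable_torusS_term hβ (V := W + 3) (by omega)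
  have hPs : Summable fun k : ℤ => a k ^ (W + 1) * J k ^ 2 :=
    summable_torusP_term hβ (V := W + 3) (by omega)
  have hZs : Summable fun k : ℤ => a k ^ (W + 3) := summable_besselI_natAbs_pow hβ (by omega)
  have hTs : Summable fun k : ℤ => a k ^ (W + 1) := summable_besselI_natAbs_pow hβ (by omega)
  show |(∑' k : ℤ, a k ^ (W + 2) * Q k) / (∑' k : ℤ, a k ^ (W + 3)) -
      (∑' k : ℤ, a k ^ (W + 1) * J k ^ 2) / (∑' k : ℤ, a k ^ (W + 3)) - v| ≤
    3 * ((∑' k : ℤ, a k ^ (W + 1)) / besselI 0 β ^ (W + 1) - 1)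
  set A := besselI 0 β ^ (W + 1) with hA
  set T := ∑' k : ℤ, a k ^ (W + 1) with hT
  set Z := ∑' k : ℤ, a k ^ (W + 3) with hZdef
  have hA0 : 0 < A := pow_pos hI0 _
  have ha00 : a 0 = besselI 0 β := by simp [ha]
  have hJ00 : J 0 = besselI 1 β := by simp [hJ]
  have hQ00 : Q 0 = (besselI 0 β + besselI 2 β) / 2 := by simp [hQ]; ring
  have hTsplit : T = A + ∑' k : ℤ, (if k = 0 then 0 else a k ^ (W + 1)) := by
    rw [hT, hTs.tsum_eq_add_tsum_ite 0, ha00]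
  have hρ0 : 0 ≤ T - A := by
    rw [hTsplit, add_sub_cancel_left]
    exact tsum_nonneg fun k => by split_ifs <;> [exact le_rfl; exact pow_nonneg (ha0 k).le _]
  have hZlo : besselI 0 β ^ 2 * A ≤ Z := by
    have h := hZs.le_tsum 0 fun k _ => (pow_pos (ha0 k) _).le
    rw [ha00] at h
    calc besselI 0 β ^ 2 * A = besselI 0 β ^ (W + 3) := by rw [hA]; ring
      _ ≤ Z := h
  have hZ0 : 0 < Z := lt_of_lt_of_le (by positivity) hZlo
  -- the combined summand and its `k = 0` cancellation
  set f : ℤ → ℝ := fun k => a k ^ (W + 2) * Q k - a k ^ (W + 1) * J k ^ 2 - v * a k ^ (W + 3) with hf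
  have hfs : Summable f := (hSs.sub hPs).sub (hZs.mul_left v)
  have hf0 : f 0 = 0 := by
    simp only [hf, ha00, hJ00, hQ00]
    rw [hv, hveq]
    field_simp
    ring
  have hnum : (∑' k : ℤ, a k ^ (W + 2) * Q k) - (∑' k : ℤ, a k ^ (W + 1) * J k ^ 2) - v * Z =
      ∑' k : ℤ, (if k = 0 then 0 else f k) := by
    rw [hZdef, ← tsum_mul_left, ← hSs.tsum_sub hPs, ← (hSs.sub hPs).tsum_sub (hZs.mul_left v),
      hfs.tsum_eq_add_tsum_ite 0]
    simp only [hf] at hf0 ⊢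
    rw [hf0, zero_add]
  -- termwise bound `|f_k| ≤ 3 a_0² a_k^{W+1}`
  have hfb : ∀ k, |f k| ≤ 3 * besselI 0 β ^ 2 * a k ^ (W + 1) := fun k => by
    have w0 : 0 ≤ a k ^ (W + 1) := pow_nonneg (ha0 k).le _
    have hx0 : 0 ≤ a k ^ (W + 2) * Q k := mul_nonneg (pow_nonneg (ha0 k).le _) (hQ0 k)
    have hx1 : a k ^ (W + 2) * Q k ≤ besselI 0 β ^ 2 * a k ^ (W + 1) := by
      calc a k ^ (W + 2) * Q k = a k ^ (W + 1) * (a k * Q k) := by ring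
        _ ≤ a k ^ (W + 1) * (besselI 0 β * besselI 0 β) :=
            mul_le_mul_of_nonneg_left (mul_le_mul (haI k) (hQI k) (hQ0 k) hI0.le) w0
        _ = _ := by ring
    have hy0 : 0 ≤ a k ^ (W + 1) * J k ^ 2 := mul_nonneg w0 (sq_nonneg _)
    have hy1 : a k ^ (W + 1) * J k ^ 2 ≤ besselI 0 β ^ 2 * a k ^ (W + 1) := by
      rw [mul_comm (besselI 0 β ^ 2)]
      exact mul_le_mul_of_nonneg_left (pow_le_pow_left₀ (hJ0 k) (hJI k) 2) w0
    have hz : |v * a k ^ (W + 3)| ≤ besselI 0 β ^ 2 * a k ^ (W + 1) := by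
      rw [abs_mul, abs_of_nonneg (pow_nonneg (ha0 k).le _)]
      calc |v| * a k ^ (W + 3) ≤ 1 * (a k ^ 2 * a k ^ (W + 1)) := by
            rw [show a k ^ (W + 3) = a k ^ 2 * a k ^ (W + 1) by ring]
            exact mul_le_mul_of_nonneg_right hv1 (by positivity)
        _ ≤ 1 * (besselI 0 β ^ 2 * a k ^ (W + 1)) := by
            refine mul_le_mul_of_nonneg_left (mul_le_mul_of_nonneg_right
              (pow_le_pow_left₀ (ha0 k).le (haI k) 2) w0) zero_le_one
        _ = _ := one_mul _
    rw [abs_le] at hz ⊢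
    constructor <;> linarith [hz.1, hz.2]
  have hite_s : Summable fun k : ℤ => (if k = 0 then 0 else f k) := by
    refine (hfs.norm).of_norm_bounded (fun k => ?_)
    split_ifs <;> simp
  have habs : |∑' k : ℤ, (if k = 0 then 0 else f k)| ≤ 3 * besselI 0 β ^ 2 * (T - A) := by
    rw [hTsplit, add_sub_cancel_left, ← tsum_mul_left]
    have hs2 : Summable fun k : ℤ => 3 * besselI 0 β ^ 2 * (if k = 0 then 0 else a k ^ (W + 1)) := by
      refine ((hTs.mul_left (3 * besselI 0 β ^ 2))).of_nonneg_of_le (fun k => ?_) (fun k => ?_)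
      · split_ifs
        · simp
        · exact mul_nonneg (by positivity) (pow_nonneg (ha0 k).le _)
      · split_ifs
        · simp only [mul_zero]; exact mul_nonneg (by positivity) (pow_nonneg (ha0 k).le _)
        · exact le_rfl
    refine (norm_tsum_le_tsum_norm hite_s.norm).trans ?_
    refine hite_s.norm.tsum_le_tsum (fun k => ?_) hs2
    split_ifs
    · simp
    · rw [Real.norm_eq_abs]; exact hfb k
  -- divide by `Z ≥ a_0² A`
  have hexpr : (∑' k : ℤ, a k ^ (W + 2) * Q k) / Z - (∑' k : ℤ, a k ^ (W + 1) * J k ^ 2) / Z - v =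
      (∑' k : ℤ, (if k = 0 then 0 else f k)) / Z := by
    rw [← hnum]
    field_simp
  rw [hexpr, abs_div, abs_of_pos hZ0, div_le_iff₀ hZ0]
  have hρeq : 3 * ((T) / A - 1) * Z = 3 * (T - A) * (Z / A) := by field_simp
  rw [hρeq]
  have hZA : besselI 0 β ^ 2 ≤ Z / A := by rw [le_div_iff₀ hA0]; exact hZlo
  calc |∑' k : ℤ, (if k = 0 then 0 else f k)| ≤ 3 * besselI 0 β ^ 2 * (T - A) := habs
    _ = 3 * (T - A) * besselI 0 β ^ 2 := by ring
    _ ≤ 3 * (T - A) * (Z / A) := mul_le_mul_of_nonneg_left hZA (by positivity)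

/-! ### 2. The finite-volume parameter and the `V → ∞` law -/

/-- **`T/A − 1 ≤ t^W (e^β − 1)`**: `Σ_{k≠0} a_k^{W+1} ≤ a_1^W (e^β − a_0)` since `a_k ≤ a_1` for `k ≠ 0`
and `Σ_{k∈ℤ} a_k = e^β`, `a_0 ≥ 1`. -/
theorem torusRho_le {β : ℝ} (hβ : 0 < β) (W : ℕ) :
    (∑' k : ℤ, besselI k.natAbs β ^ (W + 1)) / besselI 0 β ^ (W + 1) - 1 ≤
      (besselI 1 β / besselI 0 β) ^ W * (Real.exp β - 1) := by
  have hI0 : 0 < besselI 0 β := besselI_pos 0 hβ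
  have hI0' : 1 ≤ besselI 0 β := one_le_besselI_zero β
  have hI1 : 0 < besselI 1 β := besselI_pos 1 hβ
  have hTs : Summable fun k : ℤ => besselI k.natAbs β ^ (W + 1) :=
    summable_besselI_natAbs_pow hβ (by omega)
  have has := summable_besselI_natAbs β
  have hexp : ∑' k : ℤ, besselI k.natAbs β = Real.exp β := (hasSum_besselI_natAbs β).tsum_eq
  have hsplit := hTs.tsum_eq_add_tsum_ite 0
  have hsplit1 := has.tsum_eq_add_tsum_ite 0
  simp only [Int.natAbs_zero] at hsplit hsplit1
  -- the `k ≠ 0` mass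
  have hle : ∑' k : ℤ, (if k = 0 then 0 else besselI k.natAbs β ^ (W + 1)) ≤
      besselI 1 β ^ W * ∑' k : ℤ, (if k = 0 then 0 else besselI k.natAbs β) := by
    rw [← tsum_mul_left]
    have hs1 : Summable fun k : ℤ => (if k = 0 then 0 else besselI k.natAbs β ^ (W + 1)) := by
      refine hTs.of_nonneg_of_le (fun k => ?_) (fun k => ?_)
      · split_ifs
        · exact le_rfl
        · exact pow_nonneg (besselI_pos _ hβ).le _
      · split_ifs
        · exact pow_nonneg (besselI_pos _ hβ).le _
        · exact le_rfl
    have hs2 : Summable fun k : ℤ => besselI 1 β ^ W * (if k = 0 then 0 else besselI k.natAbs β) := by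
      refine (has.mul_left (besselI 1 β ^ W)).of_nonneg_of_le (fun k => ?_) (fun k => ?_)
      · split_ifs
        · simp
        · exact mul_nonneg (pow_nonneg hI1.le _) (besselI_pos _ hβ).le
      · split_ifs
        · simp only [mul_zero]; exact mul_nonneg (pow_nonneg hI1.le _) (besselI_pos _ hβ).le
        · exact le_rfl
    refine hs1.tsum_le_tsum (fun k => ?_) hs2
    split_ifs with hk
    · simp
    · rw [pow_succ]
      refine mul_le_mul_of_nonneg_right (pow_le_pow_left₀ (besselI_pos _ hβ).le ?_ W)
        (besselI_pos _ hβ).le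
      exact besselI_le_besselI_of_le (Int.natAbs_pos.mpr hk) hβ.le
  have hmass : ∑' k : ℤ, (if k = 0 then 0 else besselI k.natAbs β) = Real.exp β - besselI 0 β := by
    linarith
  rw [hmass] at hle
  rw [sub_le_iff_le_add, div_le_iff₀ (pow_pos hI0 _), hsplit]
  have key : besselI 1 β ^ W * (Real.exp β - besselI 0 β) ≤
      (besselI 1 β / besselI 0 β) ^ W * (Real.exp β - 1) * besselI 0 β ^ (W + 1) := by
    rw [div_pow, pow_succ, show (besselI 1 β ^ W / besselI 0 β ^ W) * (Real.exp β - 1) *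
      (besselI 0 β ^ W * besselI 0 β) = besselI 1 β ^ W * ((Real.exp β - 1) * besselI 0 β) by
        field_simp]
    refine mul_le_mul_of_nonneg_left ?_ (pow_nonneg hI1.le _)
    nlinarith [Real.exp_pos β, hI0']
  linarith

/-- **THE FINITE-VOLUME LAW OF THE VARIANCE OF THE VOLUME-AVERAGED PLAQUETTE** (`β > 0`, `V ≥ 3`,
`t = I₁(β)/I₀(β)`): `|V·((S/Z)/V + (1 − 1/V)(P/Z) − (N/Z)²) − (1 − t/β − t²)| ≤ (3V + 3)·t^{V−3}·(e^β − 1)`. -/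
theorem abs_torusVariance_mul_sub_le {β : ℝ} (hβ : 0 < β) {V : ℕ} (hV : 3 ≤ V) :
    |((V : ℕ) : ℝ) *
        ((∑' k : ℤ, besselI k.natAbs β ^ (V - 1) *
              ((besselI (k - 2).natAbs β + 2 * besselI k.natAbs β + besselI (k + 2).natAbs β) / 4)) /
            (∑' k : ℤ, besselI k.natAbs β ^ V) / ((V : ℕ) : ℝ) +
          (1 - 1 / ((V : ℕ) : ℝ)) *
            ((∑' k : ℤ, besselI k.natAbs β ^ (V - 2) *
                ((besselI (k - 1).natAbs β + besselI (k + 1).natAbs β) / 2) ^ 2) /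
              ∑' k : ℤ, besselI k.natAbs β ^ V) -
          ((∑' k : ℤ, besselI k.natAbs β ^ (V - 1) *
              ((besselI (k - 1).natAbs β + besselI (k + 1).natAbs β) / 2)) /
            ∑' k : ℤ, besselI k.natAbs β ^ V) ^ 2) -
      (1 - besselI 1 β / besselI 0 β / β - (besselI 1 β / besselI 0 β) ^ 2)| ≤
      (3 * ((V : ℕ) : ℝ) + 3) * (besselI 1 β / besselI 0 β) ^ (V - 3) * (Real.exp β - 1) := by
  obtain ⟨W, rfl⟩ := Nat.exists_eq_add_of_le' hV
  simp only [show W + 3 - 1 = W + 2 from rfl, show W + 3 - 2 = W + 1 from rfl,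
    show W + 3 - 3 = W from rfl]
  set Vr : ℝ := ((W + 3 : ℕ) : ℝ) with hVr
  have hV0 : 0 < Vr := by rw [hVr]; positivity
  set SZ := (∑' k : ℤ, besselI k.natAbs β ^ (W + 2) *
      ((besselI (k - 2).natAbs β + 2 * besselI k.natAbs β + besselI (k + 2).natAbs β) / 4)) /
    (∑' k : ℤ, besselI k.natAbs β ^ (W + 3)) with hSZ
  set PZ := (∑' k : ℤ, besselI k.natAbs β ^ (W + 1) *
      ((besselI (k - 1).natAbs β + besselI (k + 1).natAbs β) / 2) ^ 2) /
    (∑' k : ℤ, besselI k.natAbs β ^ (W + 3)) with hPZ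
  set NZ := (∑' k : ℤ, besselI k.natAbs β ^ (W + 2) *
      ((besselI (k - 1).natAbs β + besselI (k + 1).natAbs β) / 2)) /
    (∑' k : ℤ, besselI k.natAbs β ^ (W + 3)) with hNZ
  set v : ℝ := 1 - besselI 1 β / besselI 0 β / β - (besselI 1 β / besselI 0 β) ^ 2 with hv
  set ρ : ℝ := (∑' k : ℤ, besselI k.natAbs β ^ (W + 1)) / besselI 0 β ^ (W + 1) - 1 with hρ
  have h1 : |SZ - PZ - v| ≤ 3 * ρ := abs_torusS_div_sub_P_div_sub_le hβ W
  have h2 : 0 ≤ PZ - NZ ^ 2 := torusCov_nonneg hβ W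
  have h3 : PZ - NZ ^ 2 ≤ 3 * ρ := torusCov_le hβ W
  have h4 : ρ ≤ (besselI 1 β / besselI 0 β) ^ W * (Real.exp β - 1) := torusRho_le hβ W
  have halg : Vr * (SZ / Vr + (1 - 1 / Vr) * PZ - NZ ^ 2) - v =
      (SZ - PZ - v) + Vr * (PZ - NZ ^ 2) := by
    field_simp
    ring
  rw [halg]
  calc |SZ - PZ - v + Vr * (PZ - NZ ^ 2)| ≤ |SZ - PZ - v| + |Vr * (PZ - NZ ^ 2)| := abs_add_le _ _
    _ = |SZ - PZ - v| + Vr * (PZ - NZ ^ 2) := by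
        rw [abs_of_nonneg (mul_nonneg hV0.le h2)]
    _ ≤ 3 * ρ + Vr * (3 * ρ) := add_le_add h1 (mul_le_mul_of_nonneg_left h3 hV0.le)
    _ = (3 * Vr + 3) * ρ := by ring
    _ ≤ (3 * Vr + 3) * ((besselI 1 β / besselI 0 β) ^ W * (Real.exp β - 1)) :=
        mul_le_mul_of_nonneg_left h4 (by positivity)
    _ = _ := by ring

/-- **`V·Var(P̄) → v(β) = 1 − t/β − t²` as `V → ∞`** (`β > 0`; `0 < t = I₁/I₀ < 1`). -/
theorem tendsto_torusVariance_mul {β : ℝ} (hβ : 0 < β) :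
    Tendsto (fun V : ℕ => ((V : ℕ) : ℝ) *
        ((∑' k : ℤ, besselI k.natAbs β ^ (V - 1) *
              ((besselI (k - 2).natAbs β + 2 * besselI k.natAbs β + besselI (k + 2).natAbs β) / 4)) /
            (∑' k : ℤ, besselI k.natAbs β ^ V) / ((V : ℕ) : ℝ) +
          (1 - 1 / ((V : ℕ) : ℝ)) *
            ((∑' k : ℤ, besselI k.natAbs β ^ (V - 2) *
                ((besselI (k - 1).natAbs β + besselI (k + 1).natAbs β) / 2) ^ 2) /
              ∑' k : ℤ, besselI k.natAbs β ^ V) -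
          ((∑' k : ℤ, besselI k.natAbs β ^ (V - 1) *
              ((besselI (k - 1).natAbs β + besselI (k + 1).natAbs β) / 2)) /
            ∑' k : ℤ, besselI k.natAbs β ^ V) ^ 2))
      atTop (𝓝 (1 - besselI 1 β / besselI 0 β / β - (besselI 1 β / besselI 0 β) ^ 2)) := by
  set t := besselI 1 β / besselI 0 β with ht
  have hI0 : 0 < besselI 0 β := besselI_pos 0 hβ
  have ht0 : 0 ≤ t := div_nonneg (besselI_pos 1 hβ).le hI0.le
  have ht1 : t < 1 := (div_lt_one hI0).mpr (besselI_succ_lt 0 hβ)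
  -- the bound `(3V + 3) t^{V−3} (e^β − 1) → 0`
  have hb : Tendsto (fun V : ℕ => (3 * ((V : ℕ) : ℝ) + 3) * t ^ (V - 3) * (Real.exp β - 1))
      atTop (𝓝 0) := by
    rw [← tendsto_add_atTop_iff_nat 3]
    have e : (fun V : ℕ => (3 * (((V + 3 : ℕ)) : ℝ) + 3) * t ^ (V + 3 - 3) * (Real.exp β - 1)) =
        fun V : ℕ => (Real.exp β - 1) * (3 * ((V : ℝ) * t ^ V) + 12 * t ^ V) := by
      funext V
      simp only [show V + 3 - 3 = V from rfl]
      push_cast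
      ring
    rw [e, show (0 : ℝ) = (Real.exp β - 1) * (3 * 0 + 12 * 0) by ring]
    exact ((tendsto_self_mul_const_pow_of_lt_one ht0 ht1).const_mul 3 |>.add
      ((tendsto_pow_atTop_nhds_zero_of_lt_one ht0 ht1).const_mul 12)).const_mul _
  refine tendsto_sub_nhds_zero_iff.mp (squeeze_zero_norm' ?_ hb)
  filter_upwards [eventually_ge_atTop 3] with V hV
  rw [Real.norm_eq_abs]
  exact abs_torusVariance_mul_sub_le hβ hV

/-! ### 3. On the `L₁ × L₂` torus -/

section Torus

variable {L₁ L₂ : ℕ} [NeZero L₁] [NeZero L₂] {n : ℕ}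
  (e : Fin 2 × (Fin L₁ × Fin L₂) ≃ Fin (n + 1))

/-- **THE ERROR-BAR ORACLE OF THE 2-d `U(1)` TORUS, FINITE-VOLUME LAW.**  For `β > 0` and every
`L₁ × L₂` torus with `L₁L₂ ≥ 3`, the volume-averaged plaquette `P̄ = (Σ_x cos θ_x)/(L₁L₂)` has
`|L₁L₂·Var(P̄) − (1 − t/β − t²)| ≤ (3L₁L₂ + 3)·t^{L₁L₂−3}·(e^β − 1)`, `t = I₁(β)/I₀(β)` — so the
plaquette standard error of an ideal sampler of `M` independent configurations is `√(v(β)/(L₁L₂ M))`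
up to that exponentially small correction. -/
theorem abs_torus_plaquetteAverage_variance_mul_sub_le {β : ℝ} (hβ : 0 < β) (hV : 3 ≤ L₁ * L₂) :
    |((L₁ * L₂ : ℕ) : ℝ) *
        (u1WilsonExpect univ (torusInc e) (fun _ => β)
            (fun θ => ((∑ x, Real.cos (u1PlaqAngle (torusInc e) x θ)) / ((L₁ * L₂ : ℕ) : ℝ)) ^ 2) -
          u1WilsonExpect univ (torusInc e) (fun _ => β)
            (fun θ => (∑ x, Real.cos (u1PlaqAngle (torusInc e) x θ)) / ((L₁ * L₂ : ℕ) : ℝ)) ^ 2) -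
      (1 - besselI 1 β / besselI 0 β / β - (besselI 1 β / besselI 0 β) ^ 2)| ≤
      (3 * ((L₁ * L₂ : ℕ) : ℝ) + 3) * (besselI 1 β / besselI 0 β) ^ (L₁ * L₂ - 3) *
        (Real.exp β - 1) := by
  rw [torus_u1WilsonExpect_plaquetteAverage_variance e]
  exact abs_torusVariance_mul_sub_le hβ hV

end Torus

end Summit.Ventures.LatticeQCDFlow.Scoring
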